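import Summits.CriticalPhenomena.PercolationContinuityZ3.Theorems.Transplant.SkelNegBParamsFaceTop
import Summits.CriticalPhenomena.PercolationContinuityZ3.Theorems.Transplant.SkelNegBParamsRootA
import HarnessLib

/-!
# N1 params, chain of record `NegB`, part FaceZone: THE ZONE'S FINE FOOTPRINT IS ONE STRIDE — `kFoot₀ M_u M_u ≤ u₀ + 1`, `kFoot₁ M_u M_u ≤ u₁ + 1` at `(gT, fT)`
# (stmt-g15 2026-08-22; (F) binder map: the value for hp-8 g33's `hZk`/`hZfar` of `numsX_of_floors`/`numsY_of_floors`)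
The zone `Λc c M_u ⊆ cyl φ c M_u` has planar extents `(M_u, M_u)` about `c`, so its fine footprint (part FaceTop's `hnear₂_R` at `(sα, sβ) := (M_u, M_u)`) is
`kZ := kFoot_i M_u M_u`; since `M_u ≤ RA′`, `n_L ≥ 2000(RA′+2)`, `ℓ_L > 22000(RA′+2)` and `|v_β| ≤ ℓ_L + 10n_L + 1`, `|v_L| ≤ n_L`, `|h_L| ≤ 10n_L`, the numerator
`M_u·(|v_β| + |v_L|)` (resp. `M_u·(n_L + |h_L|)`) is below the modulus `m ≥ n_Lℓ_L − U_L + 1`, whence `kFoot_i M_u M_u ≤ u_i + 1` — ONE STRIDE: `hZfar`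
(`lev_c + kZ + 1 < 20r − b0T`, room `≈ 190u₀`) is then plain stride arithmetic. WARNING recorded for the (F) discharge (lane INBOX): reading `kZ` at the keystone's large
extents `(sαF, sβF) = (n_L + e, |h_L| + 3ℓ_L + e)` instead gives `kFoot₀ ≈ (4 + 20·n_L/ℓ_L)·u₀`, and the long box's aspect `n_L/ℓ_L` is UNBOUNDED at LEVEL 0.
builds on p205010 (kernel theorem, internal audit signed; external expert review pending) — nothing in this file uses p205010; NOTHING is claimed about
the node `SamePDropOfSkeletonNeg₁` (OPEN; its (F) column is blocked on the named LEVEL-0 statement `hlin`, lead g7 RULING E2).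
Lane `prim-bschramm-*`, seat `prim-bschramm-stmt` (gen 15); helper file (`--supports stmt-CriticalPhenomena-4575 --as helper`); ledger HOME/prim-bschramm-stmt/NEG-PARAMS.md.
* `zone_num_le` (the two numerator bounds), **`kFoot_zone_le`**.
[cite: KozmaNitzan2024, §4 Lemma 10 (pp. 17–21)] [cite: MartineauTassion2017, §4.3 Lemma 4.2]
-/

noncomputable section

open scoped Classical

namespace Summit.CriticalPhenomena.PercolationContinuityZ3.Theorems.Transplant

namespace PlanarSkeletonNeg

namespace NegB

open Literature.Probability.Percolation Literature.Probability.LatticeModels SimpleGraph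
open SkelConc (Consts)
open Skelφ (shearUnit)
open Skelφ.StepI (DataN)
open TwoAxis.Para (modulus)
open Neg

section Zone

variable (κ : Consts) {V : Type} [DecidableEq V] [Countable V] {G : SimpleGraph V} [G.LocallyFinite] (Φ : PlanarSkeletonNeg G) (t : V)
  (p : unitInterval) (D : DataN V) (mk : ℕ) (gx fx : Neg.FSlot)

/-- **The zone's planar numerators are below the modulus** at `(gT, fT)`: `M_u·(|v_β| + |v_L|) ≤ m` and `M_u·(n_L + |h_L|) ≤ m`. [folklore] -/
theorem zone_num_le (hN : EqNumL κ Φ t p D (KS.gT mk gx κ Φ t p D) (KS.fT mk fx κ Φ t p D))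
    (hκ : (hL κ Φ t p D (KS.gT mk gx κ Φ t p D) (KS.fT mk fx κ Φ t p D)).natAbs ≤ 10 * nL κ Φ t p D (KS.gT mk gx κ Φ t p D) (KS.fT mk fx κ Φ t p D)) :
    ((Mu D : ℕ) : ℤ) * (|vβL κ Φ t p D (KS.gT mk gx κ Φ t p D) (KS.fT mk fx κ Φ t p D)| + |vL κ Φ t p D (KS.gT mk gx κ Φ t p D) (KS.fT mk fx κ Φ t p D)|) ≤
        modulus (nL κ Φ t p D (KS.gT mk gx κ Φ t p D) (KS.fT mk fx κ Φ t p D)) (hL κ Φ t p D (KS.gT mk gx κ Φ t p D) (KS.fT mk fx κ Φ t p D))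
          (vL κ Φ t p D (KS.gT mk gx κ Φ t p D) (KS.fT mk fx κ Φ t p D)) (vβL κ Φ t p D (KS.gT mk gx κ Φ t p D) (KS.fT mk fx κ Φ t p D)) ∧
      ((Mu D : ℕ) : ℤ) * ((nL κ Φ t p D (KS.gT mk gx κ Φ t p D) (KS.fT mk fx κ Φ t p D) : ℤ) + |hL κ Φ t p D (KS.gT mk gx κ Φ t p D) (KS.fT mk fx κ Φ t p D)|) ≤
        modulus (nL κ Φ t p D (KS.gT mk gx κ Φ t p D) (KS.fT mk fx κ Φ t p D)) (hL κ Φ t p D (KS.gT mk gx κ Φ t p D) (KS.fT mk fx κ Φ t p D))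
          (vL κ Φ t p D (KS.gT mk gx κ Φ t p D) (KS.fT mk fx κ Φ t p D)) (vβL κ Φ t p D (KS.gT mk gx κ Φ t p D) (KS.fT mk fx κ Φ t p D)) := by
  obtain ⟨hn1, -⟩ := one_le_of_eqNumL κ Φ t p D _ _ hN
  have hvb := abs_vβL_le κ Φ t p D _ _ hN hκ
  have hv : |vL κ Φ t p D (KS.gT mk gx κ Φ t p D) (KS.fT mk fx κ Φ t p D)| ≤ nL κ Φ t p D (KS.gT mk gx κ Φ t p D) (KS.fT mk fx κ Φ t p D) := hN.v_le
  have hκ' : |hL κ Φ t p D (KS.gT mk gx κ Φ t p D) (KS.fT mk fx κ Φ t p D)| ≤ 10 * (nL κ Φ t p D (KS.gT mk gx κ Φ t p D) (KS.fT mk fx κ Φ t p D) : ℤ) := by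
    rw [← Int.natCast_natAbs]; exact_mod_cast hκ
  obtain ⟨hlo, -⟩ := modulus_top κ Φ t p D (KS.gT mk gx κ Φ t p D) (KS.fT mk fx κ Φ t p D) hn1
  have hU : (shearUnit (nL κ Φ t p D (KS.gT mk gx κ Φ t p D) (KS.fT mk fx κ Φ t p D)) (hL κ Φ t p D (KS.gT mk gx κ Φ t p D) (KS.fT mk fx κ Φ t p D)) : ℤ) =
      (nL κ Φ t p D (KS.gT mk gx κ Φ t p D) (KS.fT mk fx κ Φ t p D) : ℤ) + |hL κ Φ t p D (KS.gT mk gx κ Φ t p D) (KS.fT mk fx κ Φ t p D)| := by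
    simp only [Skelφ.shearUnit, Nat.cast_add, Int.natCast_natAbs]
  have hMu : ((Mu D : ℕ) : ℤ) + 2 ≤ (KS.RA' κ Φ t p D mk : ℤ) := by exact_mod_cast KS.Mu_add_two_le_RA' κ Φ t p D mk
  have hn := KS.nL_floorT_int κ Φ t p D mk fx (KS.gT mk gx κ Φ t p D)
  have hℓ := KS.ℓL_ge_T κ Φ t p D mk gx (KS.fT mk fx κ Φ t p D) hN
  have hM0 : (0 : ℤ) ≤ ((Mu D : ℕ) : ℤ) := by positivity
  have hR0 : (0 : ℤ) ≤ (KS.RA' κ Φ t p D mk : ℤ) := by positivity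
  set n : ℤ := (nL κ Φ t p D (KS.gT mk gx κ Φ t p D) (KS.fT mk fx κ Φ t p D) : ℤ) with hndef
  set ℓ : ℤ := (ℓL κ Φ t p D (KS.gT mk gx κ Φ t p D) (KS.fT mk fx κ Φ t p D) : ℤ) with hℓdef
  set R : ℤ := (KS.RA' κ Φ t p D mk : ℤ) with hRdef
  set M : ℤ := ((Mu D : ℕ) : ℤ) with hMdef
  rw [hU] at hlo
  -- `M ≤ R`, `2000 R ≤ n`, `22000 R ≤ ℓ`: the numerators are `≤ R(ℓ + 11n + 1)` resp. `≤ 11 R n`, the modulus is `≥ nℓ − 11n`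
  have h1 : M * (|vβL κ Φ t p D (KS.gT mk gx κ Φ t p D) (KS.fT mk fx κ Φ t p D)| + |vL κ Φ t p D (KS.gT mk gx κ Φ t p D) (KS.fT mk fx κ Φ t p D)|) ≤
      R * (ℓ + 11 * n + 1) := by
    have : |vβL κ Φ t p D (KS.gT mk gx κ Φ t p D) (KS.fT mk fx κ Φ t p D)| + |vL κ Φ t p D (KS.gT mk gx κ Φ t p D) (KS.fT mk fx κ Φ t p D)| ≤ ℓ + 11 * n + 1 := by
      linarith
    calc M * _ ≤ M * (ℓ + 11 * n + 1) := mul_le_mul_of_nonneg_left this hM0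
      _ ≤ R * (ℓ + 11 * n + 1) := by apply mul_le_mul_of_nonneg_right (by linarith) (by positivity)
  have h2 : M * (n + |hL κ Φ t p D (KS.gT mk gx κ Φ t p D) (KS.fT mk fx κ Φ t p D)|) ≤ R * (11 * n) := by
    have : n + |hL κ Φ t p D (KS.gT mk gx κ Φ t p D) (KS.fT mk fx κ Φ t p D)| ≤ 11 * n := by linarith
    calc M * _ ≤ M * (11 * n) := mul_le_mul_of_nonneg_left this hM0
      _ ≤ R * (11 * n) := by apply mul_le_mul_of_nonneg_right (by linarith) (by positivity)
  have h3 : R * (ℓ + 11 * n + 1) ≤ n * ℓ - (n + 10 * n) + 1 := by nlinarith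
  have h4 : R * (11 * n) ≤ n * ℓ - (n + 10 * n) + 1 := by nlinarith
  have hlo' : n * ℓ - (n + 10 * n) + 1 ≤
      modulus (nL κ Φ t p D (KS.gT mk gx κ Φ t p D) (KS.fT mk fx κ Φ t p D)) (hL κ Φ t p D (KS.gT mk gx κ Φ t p D) (KS.fT mk fx κ Φ t p D))
        (vL κ Φ t p D (KS.gT mk gx κ Φ t p D) (KS.fT mk fx κ Φ t p D)) (vβL κ Φ t p D (KS.gT mk gx κ Φ t p D) (KS.fT mk fx κ Φ t p D)) := by
    nlinarith [abs_nonneg (hL κ Φ t p D (KS.gT mk gx κ Φ t p D) (KS.fT mk fx κ Φ t p D))]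
  exact ⟨by linarith, by linarith⟩

/-- **THE ZONE'S FINE FOOTPRINT IS AT MOST ONE STRIDE**: `kFoot₀ M_u M_u ≤ u₀ + 1` and `kFoot₁ M_u M_u ≤ u₁ + 1` at `(gT, fT)` — the value of hp-8's `kZ` (both faces). [folklore] -/
theorem kFoot_zone_le (hN : EqNumL κ Φ t p D (KS.gT mk gx κ Φ t p D) (KS.fT mk fx κ Φ t p D))
    (hκ : (hL κ Φ t p D (KS.gT mk gx κ Φ t p D) (KS.fT mk fx κ Φ t p D)).natAbs ≤ 10 * nL κ Φ t p D (KS.gT mk gx κ Φ t p D) (KS.fT mk fx κ Φ t p D)) :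
    kFoot₀ κ Φ t p D (KS.gT mk gx κ Φ t p D) (KS.fT mk fx κ Φ t p D) (Mu D) (Mu D) ≤ KS.u₀ κ Φ t p D (KS.gT mk gx κ Φ t p D) (KS.fT mk fx κ Φ t p D) + 1 ∧
      kFoot₁ κ Φ t p D (KS.gT mk gx κ Φ t p D) (KS.fT mk fx κ Φ t p D) (Mu D) (Mu D) ≤ KS.u₁ κ Φ t p D (KS.gT mk gx κ Φ t p D) (KS.fT mk fx κ Φ t p D) + 1 := by
  obtain ⟨hA, hc0, hc1, hu0, hu1, hm, hDm, -, -, -, -, -, -⟩ := lattice_R κ Φ t p D (KS.gT mk gx κ Φ t p D) (KS.fT mk fx κ Φ t p D) hN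
  obtain ⟨z0, z1⟩ := zone_num_le κ Φ t p D mk gx fx hN hκ
  obtain ⟨hA', hn', hh', hvα', hvβ', -, -, -⟩ := prF_fields κ Φ t p D (KS.gT mk gx κ Φ t p D) (KS.fT mk fx κ Φ t p D)
  set pr := prF κ Φ t p D (KS.gT mk gx κ Φ t p D) (KS.fT mk fx κ Φ t p D) with hpr
  set m := modulus (nL κ Φ t p D (KS.gT mk gx κ Φ t p D) (KS.fT mk fx κ Φ t p D)) (hL κ Φ t p D (KS.gT mk gx κ Φ t p D) (KS.fT mk fx κ Φ t p D))
    (vL κ Φ t p D (KS.gT mk gx κ Φ t p D) (KS.fT mk fx κ Φ t p D)) (vβL κ Φ t p D (KS.gT mk gx κ Φ t p D) (KS.fT mk fx κ Φ t p D)) with hmdef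
  have hA8 : pr.A = 800 := hA'
  have hAabs : |pr.A| = 800 := by rw [hA8]; norm_num
  have hD0 : 0 < pr.D := by rw [hDm]; positivity
  constructor
  · -- numerator `c₀·|A|·(|vβ|·M + |vL|·M) = A·u₀·A·M·(|vβ| + |vL|) ≤ u₀·(A²·m) = u₀·D`
    unfold kFoot₀
    have key : pr.c₀ * (|pr.A| * (|pr.vβ| * ((Mu D : ℕ) : ℤ) + |pr.vα| * ((Mu D : ℕ) : ℤ))) ≤
        KS.u₀ κ Φ t p D (KS.gT mk gx κ Φ t p D) (KS.fT mk fx κ Φ t p D) * pr.D := by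
      rw [hc0, hDm, hAabs, hA8, hvα', hvβ']
      have e : (800 : ℤ) * KS.u₀ κ Φ t p D (KS.gT mk gx κ Φ t p D) (KS.fT mk fx κ Φ t p D) *
          (800 * (|vβL κ Φ t p D (KS.gT mk gx κ Φ t p D) (KS.fT mk fx κ Φ t p D)| * ((Mu D : ℕ) : ℤ) +
            |vL κ Φ t p D (KS.gT mk gx κ Φ t p D) (KS.fT mk fx κ Φ t p D)| * ((Mu D : ℕ) : ℤ))) =
          KS.u₀ κ Φ t p D (KS.gT mk gx κ Φ t p D) (KS.fT mk fx κ Φ t p D) * (800 ^ 2 * (((Mu D : ℕ) : ℤ) *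
            (|vβL κ Φ t p D (KS.gT mk gx κ Φ t p D) (KS.fT mk fx κ Φ t p D)| + |vL κ Φ t p D (KS.gT mk gx κ Φ t p D) (KS.fT mk fx κ Φ t p D)|))) := by ring
      rw [e]
      exact mul_le_mul_of_nonneg_left (mul_le_mul_of_nonneg_left z0 (by norm_num)) hu0
    have := Int.ediv_le_of_le_mul hD0 key
    linarith
  · unfold kFoot₁
    have key : pr.c₁ * (|pr.A| * (|(pr.n : ℤ)| * ((Mu D : ℕ) : ℤ) + |pr.h| * ((Mu D : ℕ) : ℤ))) ≤
        KS.u₁ κ Φ t p D (KS.gT mk gx κ Φ t p D) (KS.fT mk fx κ Φ t p D) * pr.D := by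
      rw [hc1, hDm, hAabs, hA8, hn', hh', Nat.abs_cast]
      have e : (800 : ℤ) * KS.u₁ κ Φ t p D (KS.gT mk gx κ Φ t p D) (KS.fT mk fx κ Φ t p D) *
          (800 * ((nL κ Φ t p D (KS.gT mk gx κ Φ t p D) (KS.fT mk fx κ Φ t p D) : ℤ) * ((Mu D : ℕ) : ℤ) +
            |hL κ Φ t p D (KS.gT mk gx κ Φ t p D) (KS.fT mk fx κ Φ t p D)| * ((Mu D : ℕ) : ℤ))) =
          KS.u₁ κ Φ t p D (KS.gT mk gx κ Φ t p D) (KS.fT mk fx κ Φ t p D) * (800 ^ 2 * (((Mu D : ℕ) : ℤ) *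
            ((nL κ Φ t p D (KS.gT mk gx κ Φ t p D) (KS.fT mk fx κ Φ t p D) : ℤ) + |hL κ Φ t p D (KS.gT mk gx κ Φ t p D) (KS.fT mk fx κ Φ t p D)|))) := by ring
      rw [e]
      exact mul_le_mul_of_nonneg_left (mul_le_mul_of_nonneg_left z1 (by norm_num)) hu1
    have := Int.ediv_le_of_le_mul hD0 key
    linarith

end Zone

end NegB

end PlanarSkeletonNeg

end Summit.CriticalPhenomena.PercolationContinuityZ3.Theorems.Transplant

end
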